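import Summits.QuantumFields.BalabanUV.Beta.D1BFx.FineHessianWardRelative

/-!
# `BalabanUV.Beta.FP.LetterScaling` — road «FP» for binder row D1, row N3-fine ∕ N3(ii)–(iv), GENERIC PART 2: THE THREE LETTER SHAPES OF
# `FP/PerfectFineWard` UNDER THE CELL's CHANGE OF UNITS (fibrewise CONGRUENCE scaling `A ↦ D A D`, `𝕄 ↦ D⁻¹ 𝕄 D⁻¹`, jets `↦ D⁻¹ · D⁻¹`;
# `HessKerRate.scaleK`, `HessKerDressedUnits.unitK ∕ counitK`): relative inverse (K), `conjV`-laws (S), `conjW`-laws and tadpole-null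
# remainders (W) are COVARIANT when the projector `E` and the generators commute with the scaling

HONEST DEPENDENCY (page 1, mandatory): continuum YM on T⁴ ⇐ BetaPertH ∧ nine spine estimates (0/9 proved); BetaPertH ⇐ (D1) ∧ (D4) ∧
CAP+tail; G-an2-4 gates asym, D1 and NE2/3/4.  HONEST FRAMING (cell contract, verbatim): «discharging `BetaPertH` makes Bałaban's UV
stability UNCONDITIONAL — a real constructive-QFT result; it is NOT the continuum limit and NOT the Clay problem.»  [folklore] algebra
over `HessKerRate.scaleK` ∕ `comp_scaleK` ∕ `tadpole_scaleK` and an2∕an5's `ChartConjugation(Relative)` BY NAME; no definition, no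
`def … : Prop`, nothing cited, 0 sorry; no perfect object touched; 0∕4 binders of row D1; NOT the letters, NOT hrep, NOT D1, NOT BetaPertH, NOT
continuum, NOT Clay.  ABSOLUTE RULE (cell charter, verbatim): «No internally-minted statement may enter as a cited fact. Every hypothesis
is either kernel-proved in this package or a verbatim quotation of a PUBLISHED theorem with page reference. The manuscript(s) under audit are
NOT citable for their own disputed steps — they are the thing under adjudication; programme-internal (2001/route/tribunal) claims are never
citable.»

WHY.  The perfect family of road FP is a limit of UNIT-RESCALED wall objects (`HessKerDressedUnits.unitK sf sm K = D K D`,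
`unitS = (sf·sm)⁻¹ • D⁻¹ S D⁻¹`, `unitW = D⁻¹ W D⁻¹`, `D = legScale sf sm`), while the finite-`j` letters (leaf-10's `hSd_SrecAt`, the
`RelInv` of the hR chain, an1's table laws) are stated for the UNSCALED objects.  Before `FP/LetterInheritance` can pass the letters to the
limit, each letter must be moved to the rescaled objects at every `j`; THIS FILE shows the three letter SHAPES are covariant under the
congruence scaling, with the projector `E` fixed and the chart operator `𝕄` rescaled CONTRAGREDIENTLY (`D⁻¹ 𝕄 D⁻¹`), provided `E` and the
generators are invariant under the SIMILARITY `D · D⁻¹` (true for kernels block-diagonal in the field ∕ multiplier legs when `D` is constant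
on each block — `axEc`, `diagK`).

CONTENT (all [folklore]; any `D`, finite fibre `F`; `u·u′ = 1` fibrewise).
* §1 `scaleK_sub`, `scaleK_add`, `scaleK_smul`, `scaleK_zero`, `scaleK_finset_sum`; `comp_scaleK_simil_left∕right` (products against a
  similarity-invariant letter).
* §2 **`relInv_scaleK`**: `RelInv A 𝕄 E`, `scaleK u u′ E = E = scaleK u′ u E` ⟹ `RelInv (scaleK u u A) (scaleK u′ u′ 𝕄) E`.
* §3 **`conjV_scaleK`**: `scaleK u u′ X = X = scaleK u′ u X` ⟹ `conjV (scaleK u′ u′ 𝕄) X = scaleK u′ u′ (conjV 𝕄 X)`; `divV_scaleK_smul`,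
  `sum_divV_scaleK_smul`; **`blockWard_scaleK`**: `cH • Σ_{v∈T} divV S (w v) = conjV 𝕄 X` ⟹ the same law for `S′ := c • D⁻¹ S D⁻¹`,
  `𝕄′ := D⁻¹ 𝕄 D⁻¹`, generator `c • X` (same `cH`).
* §4 `tadpole_scaleK_eq_zero` (tadpole-null remainders stay null), `conjW_zero_eq`, **`conjW_zero_scaleK`** (the (W2♮) contact of `FP/PerfectFineWard`'s shape,
  `conjW 𝕄 0 V X 0 X₂`, under `V ↦ c • D⁻¹ V D⁻¹`, `X ↦ c⁻¹ • X`, `X₂ ↦ X₂`, `𝕄 ↦ D⁻¹ 𝕄 D⁻¹`), **`wardW_scaleK`** (the (W2♮) law for the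
  rescaled table `D⁻¹ W D⁻¹` from the unscaled one).
Unit `b2b-balaban-beta-d1-formalise-leaf-01` (gen 5), 2026-08-20; claim table `HOME/b2b-balaban-beta-d1-p3/LEAVES-FP.md` (N3-fine ∕ N3(ii)–(iv), R-FP-10).
-/

noncomputable section

namespace Summit.QuantumFields.BalabanUV.Beta.FP.LetterScaling

open Finset
open scoped BigOperators
open Literature.MathematicalPhysics.QuantumFieldTheory.Balaban1983to89
open Literature.MathematicalPhysics.QuantumFieldTheory.Balaban1983to89.Beta
open ExpKernelCalculus (MKer comp tr tadpole)
open HessKerRate (scaleK scaleK_apply comp_scaleK tadpole_scaleK)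
open Summit.QuantumFields.BalabanUV.Beta.ChartConjugation (conjV conjW conjW₁ conjW₂)
open Summit.QuantumFields.BalabanUV.Beta.ChartConjugationRelative (RelInv)
open Summit.QuantumFields.BalabanUV.Beta.D1BFx (FineHessianWardRelative.conjV_smul)
open Summit.QuantumFields.BalabanUV.Beta (KernelWardRelative.comp_zero_left)

variable {D : ℕ} {F : Type*} [Fintype F]

/-! ## §1 Linearity of the rescaling; products against similarity-invariant letters -/

section Linear

omit [Fintype F]

/-- [folklore] `scaleK` of a difference. -/
theorem scaleK_sub (u v : F → ℝ) (K L : MKer D F) : scaleK u v (K - L) = scaleK u v K - scaleK u v L := by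
  funext x y a b; simp only [scaleK_apply, Pi.sub_apply]; ring

/-- [folklore] `scaleK` of a sum. -/
theorem scaleK_add (u v : F → ℝ) (K L : MKer D F) : scaleK u v (K + L) = scaleK u v K + scaleK u v L := by
  funext x y a b; simp only [scaleK_apply, Pi.add_apply]; ring

/-- [folklore] `scaleK` of a scalar multiple. -/
theorem scaleK_smul (u v : F → ℝ) (c : ℝ) (K : MKer D F) : scaleK u v (c • K) = c • scaleK u v K := by
  funext x y a b; simp only [scaleK_apply, Pi.smul_apply, smul_eq_mul]; ring

/-- [folklore] `scaleK` of zero. -/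
theorem scaleK_zero (u v : F → ℝ) : scaleK u v (0 : MKer D F) = 0 := by
  funext x y a b; simp only [scaleK_apply, Pi.zero_apply, mul_zero, zero_mul]

/-- [folklore] `scaleK` of a finite sum. -/
theorem scaleK_finset_sum {ι : Type*} (u v : F → ℝ) (s : Finset ι) (K : ι → MKer D F) :
    scaleK u v (∑ i ∈ s, K i) = ∑ i ∈ s, scaleK u v (K i) := by
  classical
  refine Finset.induction_on s ?_ ?_
  · simp only [Finset.sum_empty, scaleK_zero]
  · intro i s hi ih
    rw [Finset.sum_insert hi, Finset.sum_insert hi, scaleK_add, ih]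

end Linear

section Products

/-- [folklore] Right product against a letter invariant under the similarity `u · u′`: `(u′Mu′)∘X = u′(M∘X)u′`. -/
theorem comp_scaleK_simil_right (u u' : F → ℝ) (hu : ∀ a, u a * u' a = 1) (M X : MKer D F) (hX : scaleK u u' X = X) :
    comp (scaleK u' u' M) X = scaleK u' u' (comp M X) := by
  conv_lhs => rw [← hX]
  exact comp_scaleK u' u' u u' (fun a => by rw [mul_comm]; exact hu a) M X

/-- [folklore] Left product against a letter invariant under the similarity `u′ · u`: `X∘(u′Mu′) = u′(X∘M)u′`. -/
theorem comp_scaleK_simil_left (u u' : F → ℝ) (hu : ∀ a, u a * u' a = 1) (M X : MKer D F) (hX : scaleK u' u X = X) :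
    comp X (scaleK u' u' M) = scaleK u' u' (comp X M) := by
  conv_lhs => rw [← hX]
  exact comp_scaleK u' u u' u' hu X M

end Products

/-! ## §2 The relative inverse under congruence scaling -/

/-- [folklore] **THE RELATIVE-INVERSE LETTER IS COVARIANT**: `RelInv A 𝕄 E` with a projector invariant under both similarities
(`scaleK u u′ E = E`, `scaleK u′ u E = E`; `u·u′ = 1`) ⟹ `RelInv (scaleK u u A) (scaleK u′ u′ 𝕄) E` — the resolvent rescaled as a
congruence `D A D` (`unitK`), the chart operator contragrediently `D⁻¹ 𝕄 D⁻¹`. -/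
theorem relInv_scaleK {A M E : MKer D F} (u u' : F → ℝ) (hu : ∀ a, u a * u' a = 1) (h : RelInv A M E)
    (hE : scaleK u u' E = E) (hE' : scaleK u' u E = E) : RelInv (scaleK u u A) (scaleK u' u' M) E := by
  have hu' : ∀ a, u' a * u a = 1 := fun a => by rw [mul_comm]; exact hu a
  obtain ⟨h1, h2, h3, h4⟩ := h
  refine ⟨?_, ?_, ?_, ?_⟩
  · conv_lhs => rw [← hE]
    rw [comp_scaleK u u' u u hu', h1]
  · conv_lhs => rw [← hE']
    rw [comp_scaleK u u u' u hu, h2]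
  · rw [comp_scaleK u u u' u' hu]
    conv_lhs => rw [← hE]
    rw [comp_scaleK u u' u u' hu', h3, hE]
  · conv_lhs => rw [← hE']
    rw [comp_scaleK u' u u' u' hu, comp_scaleK u' u' u u hu', h4, hE']

/-! ## §3 `conjV`-laws (the block-stencil Ward letter) under congruence scaling -/

/-- [folklore] **THE FIRST-ORDER CONTACT IS COVARIANT**: for a generator invariant under both similarities,
`conjV (u′𝕄u′) X = u′ (conjV 𝕄 X) u′`. -/
theorem conjV_scaleK {M X : MKer D F} (u u' : F → ℝ) (hu : ∀ a, u a * u' a = 1) (hX : scaleK u u' X = X)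
    (hX' : scaleK u' u X = X) : conjV (scaleK u' u' M) X = scaleK u' u' (conjV M X) := by
  unfold ChartConjugation.conjV
  rw [comp_scaleK_simil_right u u' hu M X hX, comp_scaleK_simil_left u u' hu M X hX', scaleK_sub]

omit [Fintype F] in
/-- [folklore] The pure-gauge vertex of the rescaled family `κ x ↦ c • u′(S κ x)u′` is `c • u′(divV S y)u′`. -/
theorem divV_scaleK_smul (u' : F → ℝ) (c : ℝ) (S : Fin D → (Fin D → ℤ) → MKer D F) (y : Fin D → ℤ) :
    KernelWard.divV (fun κ x => c • scaleK u' u' (S κ x)) y = c • scaleK u' u' (KernelWard.divV S y) := by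
  simp only [KernelWard.divV, scaleK_finset_sum, scaleK_sub, Finset.smul_sum, smul_sub]

omit [Fintype F] in
/-- [folklore] … and so is its block sum. -/
theorem sum_divV_scaleK_smul {ι : Type*} (T : Finset ι) (w : ι → (Fin D → ℤ)) (u' : F → ℝ) (c : ℝ)
    (S : Fin D → (Fin D → ℤ) → MKer D F) :
    ∑ v ∈ T, KernelWard.divV (fun κ x => c • scaleK u' u' (S κ x)) (w v) = c • scaleK u' u' (∑ v ∈ T, KernelWard.divV S (w v)) := by
  simp only [divV_scaleK_smul, scaleK_finset_sum, Finset.smul_sum]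

/-- [folklore] **THE BLOCK-STENCIL WARD LETTER IS COVARIANT** (letter (S) of `FP/PerfectFineWard`): from
`cH • Σ_{v∈T} divV S (w v) = conjV 𝕄 X` for the unscaled objects, the SAME law for the rescaled stencils `S′ κ x := c • u′(S κ x)u′`
(`HessKerDressedUnits.unitS` shape), the contragredient chart operator `u′𝕄u′` and the generator `c • X` (X invariant under the similarities). -/
theorem blockWard_scaleK {S : Fin D → (Fin D → ℤ) → MKer D F} {M X : MKer D F} {cH : ℝ} {ι : Type*} (T : Finset ι)
    (w : ι → (Fin D → ℤ)) (u u' : F → ℝ) (hu : ∀ a, u a * u' a = 1) (hX : scaleK u u' X = X) (hX' : scaleK u' u X = X) (c : ℝ)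
    (hlaw : cH • ∑ v ∈ T, KernelWard.divV S (w v) = conjV M X) :
    cH • ∑ v ∈ T, KernelWard.divV (fun κ x => c • scaleK u' u' (S κ x)) (w v) = conjV (scaleK u' u' M) (c • X) := by
  rw [sum_divV_scaleK_smul, smul_comm, ← scaleK_smul, hlaw, FineHessianWardRelative.conjV_smul, conjV_scaleK u u' hu hX hX']

/-! ## §4 Tadpole-null remainders and the (W2♮) contact under congruence scaling -/

/-- [folklore] A tadpole-null remainder stays tadpole-null: `tadpole (uAu) (u′Nu′) = tadpole A N` (`HessKerRate.tadpole_scaleK`). -/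
theorem tadpole_scaleK_eq_zero {A N : MKer D F} (u u' : F → ℝ) (hu : ∀ a, u a * u' a = 1) (h : tadpole A N = 0) :
    tadpole (scaleK u u A) (scaleK u' u' N) = 0 := by
  rw [tadpole_scaleK u u' hu, h]

/-- [folklore] The (W2♮) contact of `FP/PerfectFineWard`'s shape, with its zero slots evaluated:
`conjW 𝕄 0 V X 0 X₂ = (V∘X − X∘V) + (𝕄∘X₂ − X₂∘𝕄)`. -/
theorem conjW_zero_eq (M V X X₂ : MKer D F) : conjW M 0 V X 0 X₂ = (comp V X - comp X V) + (comp M X₂ - comp X₂ M) := by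
  simp only [ChartConjugation.conjW, ChartConjugation.conjW₁, ChartConjugation.conjW₂, StepDriftWitness.comp_zero_right, KernelWardRelative.comp_zero_left,
    add_zero, zero_add, sub_self]

/-- [folklore] **THE (W2♮) CONTACT OF `FP/PerfectFineWard`'s SHAPE IS COVARIANT**: `conjW 𝕄 0 V X 0 X₂` under `𝕄 ↦ u′𝕄u′`,
`V ↦ c • u′Vu′`, `X ↦ c⁻¹ • X`, `X₂ ↦ X₂` (`X`, `X₂` invariant under the similarities, `c ≠ 0`) becomes `u′ (conjW 𝕄 0 V X 0 X₂) u′`. -/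
theorem conjW_zero_scaleK {M V X X₂ : MKer D F} (u u' : F → ℝ) (hu : ∀ a, u a * u' a = 1) (hX : scaleK u u' X = X)
    (hX' : scaleK u' u X = X) (hX₂ : scaleK u u' X₂ = X₂) (hX₂' : scaleK u' u X₂ = X₂) {c : ℝ} (hc : c ≠ 0) :
    conjW (scaleK u' u' M) 0 (c • scaleK u' u' V) (c⁻¹ • X) 0 X₂ = scaleK u' u' (conjW M 0 V X 0 X₂) := by
  rw [conjW_zero_eq, conjW_zero_eq, scaleK_add, scaleK_sub, scaleK_sub, KernelReflection.comp_smul_left, KernelReflection.comp_smul_right,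
    KernelReflection.comp_smul_right, KernelReflection.comp_smul_left, smul_smul, smul_smul, mul_inv_cancel₀ hc, one_smul,
    one_smul, comp_scaleK_simil_right u u' hu V X hX, comp_scaleK_simil_left u u' hu V X hX',
    comp_scaleK_simil_right u u' hu M X₂ hX₂, comp_scaleK_simil_left u u' hu M X₂ hX₂']

/-- [folklore] **THE (W2♮) LETTER IS COVARIANT** (letter (W) of `FP/PerfectFineWard`): from the unscaled law
`L = conjW 𝕄 0 V X 0 X₂ + N`, the rescaled one `u′Lu′ = conjW (u′𝕄u′) 0 (c • u′Vu′) (c⁻¹ • X) 0 X₂ + u′Nu′`. -/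
theorem wardW_scaleK {L M V X X₂ N : MKer D F} (u u' : F → ℝ) (hu : ∀ a, u a * u' a = 1) (hX : scaleK u u' X = X)
    (hX' : scaleK u' u X = X) (hX₂ : scaleK u u' X₂ = X₂) (hX₂' : scaleK u' u X₂ = X₂) {c : ℝ} (hc : c ≠ 0)
    (hlaw : L = conjW M 0 V X 0 X₂ + N) :
    scaleK u' u' L = conjW (scaleK u' u' M) 0 (c • scaleK u' u' V) (c⁻¹ • X) 0 X₂ + scaleK u' u' N := by
  rw [hlaw, scaleK_add, conjW_zero_scaleK u u' hu hX hX' hX₂ hX₂' hc]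

end Summit.QuantumFields.BalabanUV.Beta.FP.LetterScaling

end
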